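import Summits.FinalStateConjecture.FinalStateConjecture.Theorems.KerrShieldedDataExist.Negative.BentHeight
import Mathlib.Analysis.SpecialFunctions.Log.Deriv
import Mathlib.Analysis.SpecialFunctions.SmoothTransition
import HarnessLib

/-!
# `KerrShieldedDataExist` — the hard-coded bent height is `C^∞` (support lemma)

Support lemma for crux `stmt-FinalStateConjecture-10055`
(`Summit.FinalStateConjecture.FinalStateConjecture.Theses.SwallowTheDatum.KerrShieldedDataExist`; the same
height is hard-coded in `ParametricKerrBurial` and `KerrShieldedSettles` of route SwallowTheDatum), filed by the
route's deep-refute seat (drefute, line `plug-the-second-sheet`): the reshaped skeleton's `stub_sliceClause`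
exports, and its `stub_harvest` consumes, `ContDiff ℝ ∞ (Negative.bentHeight M 0)`. This file proves it for every
sub-extremal `|a| < M` (and packages the `a = 0` case): the literal height
`T(r) = χ(r/4M − 1) · (F(r) − F(4M))` is identically `0` on the open set `{r < 4M}`
(`bentHeight_eq_zero_of_le` — the `Real.log` junk below `r₊` never leaks), and on the open set `{r > r₊}`
(which contains `[4M, ∞)` since `r₊ < 4M`) it is a product/difference of `C^∞` functions, both logarithms
`log(r − r₊)`, `log(r − r₋)` having positive arguments. No statement of the route is asserted.
References: Dafermos–Rodnianski arXiv:0811.0354 §5.1 (the Kerr-star / Boyer–Lindquist height).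
-/

set_option linter.dupNamespace false

noncomputable section

open Real Set Filter Topology
open scoped ContDiff
open Literature.Geometry.Lorentzian

namespace Summit.FinalStateConjecture.FinalStateConjecture.Theorems.KerrShieldedDataExist.Negative

variable {M a : ℝ}

/-- The Boyer–Lindquist height `F = blHeight M a` is `C^n` at every `r > r₊`: both logarithms have positive
arguments there (`r − r₊ > 0`, `r − r₋ > 0`). [cite: arXiv08110354, §5.1] -/
theorem contDiffAt_blHeight (h : |a| < M) {n : WithTop ℕ∞} {r : ℝ} (hr : Kerr.rPlus M a < r) :
    ContDiffAt ℝ n (blHeight M a) r := by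
  have hrp : r - Kerr.rPlus M a ≠ 0 := (sub_pos.2 hr).ne'
  have hrm : r - Kerr.rMinus M a ≠ 0 := (sub_pos.2 ((rMinus_lt_rPlus h).trans hr)).ne'
  unfold blHeight
  apply ContDiffAt.mul contDiffAt_const
  apply ContDiffAt.sub
  · exact contDiffAt_const.mul ((contDiffAt_id.sub contDiffAt_const).log hrp)
  · exact contDiffAt_const.mul ((contDiffAt_id.sub contDiffAt_const).log hrm)

/-- **The literal bent height is smooth.** For sub-extremal parameters `|a| < M` the crux's hard-coded height
`bentHeight M a` is `C^n` on all of `ℝ` for every `n : ℕ∞` (in particular `C^∞`): it vanishes identically on the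
open set `{r < 4M}` and is a product of `C^∞` functions on the open set `{r > r₊} ⊇ [4M, ∞)`.
[cite: arXiv08110354, §5.1] -/
theorem contDiff_bentHeight (h : |a| < M) {n : ℕ∞} : ContDiff ℝ n (bentHeight M a) := by
  have hM : 0 < M := mass_pos h
  rw [contDiff_iff_contDiffAt]
  intro x
  rcases lt_or_ge x (4 * M) with hx | hx
  · have hx0 : bentHeight M a =ᶠ[𝓝 x] fun _ => (0 : ℝ) := by
      filter_upwards [Iio_mem_nhds hx] with r hr
      exact bentHeight_eq_zero_of_le hM hr.le
    exact contDiffAt_const.congr_of_eventuallyEq hx0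
  · have hx' : Kerr.rPlus M a < x := (rPlus_lt_four_mul h).trans_le hx
    unfold bentHeight
    apply ContDiffAt.mul
    · exact Real.smoothTransition.contDiff.contDiffAt.comp x
        ((contDiffAt_id.div_const (4 * M)).sub contDiffAt_const)
    · exact (contDiffAt_blHeight h hx').sub contDiffAt_const

/-- The `a = 0` case consumed by the line `plug-the-second-sheet` (`stub_sliceClause` (i) / `stub_harvest`):
`ContDiff ℝ n (Negative.bentHeight M 0)` for `M > 0`, every `n : ℕ∞`. [cite: arXiv08110354, §5.1] -/
theorem contDiff_bentHeight_zero_spin (hM : 0 < M) {n : ℕ∞} : ContDiff ℝ n (bentHeight M 0) :=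
  contDiff_bentHeight (a := 0) (by simpa using hM)

/-- Instance of the previous lemma at `n = ∞`, literally the first conjunct of the reshaped `stub_sliceClause`.
[cite: arXiv08110354, §5.1] -/
theorem contDiff_top_bentHeight_zero_spin (hM : 0 < M) : ContDiff ℝ ∞ (bentHeight M 0) :=
  contDiff_bentHeight_zero_spin hM

end Summit.FinalStateConjecture.FinalStateConjecture.Theorems.KerrShieldedDataExist.Negative

end
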